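import Mathlib.Combinatorics.SimpleGraph.Coloring.Vertex
import Mathlib.Analysis.SpecialFunctions.Pow.Real
import Mathlib.Tactic
import HarnessLib

/-!
# The Moser spindle: a 7-vertex unit-distance graph with chromatic number 4

L. Moser and W. Moser (1961) exhibited seven points of the Euclidean plane whose unit-distance graph
is not 3-colourable (the "Moser spindle"; 7 vertices, 11 edges).  We record

* the abstract graph `moserSpindle : SimpleGraph (Fin 7)` (its 11 edges as an explicit list),
* an EXACT embedding `pt : Fin 7 → ℝ × ℝ` with coordinates in `ℚ(√3, √11)`, following the description
  `(A ⊕ B) ∪ θ₃(A ⊕ B)` of Heule (2018, §2.1): `A = {(0,0),(1,0)}`, `B = {(0,0),(1/2,√3/2)}`, `θ₃` the rotation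
  about the origin with `cos θ₃ = 5/6`, `sin θ₃ = √11/6`,
* `adj_sqDist_eq_one`: adjacent vertices are at (squared) Euclidean distance exactly `1`,
* `pt_injective`: the seven points are distinct,
* `not_colorable_three` and `colorable_four`: the chromatic number is `4`.

All distance identities are polynomial identities in `√3, √11` modulo `(√3)² = 3`, `(√11)² = 11`, discharged by
`ring_nf` + rewriting; the colouring statements are finite checks (`decide`).  Written as the kernel-checked smallest
positive control of the unit-distance-graph census (every verdict in exact arithmetic).  Deliberately NOT here: the
general notion of a unit-distance graph / the chromatic number of the plane (no Mathlib API yet), and any 5-chromatic graph.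

Sources: [MoserMoser1961]; construction as printed in [Heule2018SmallUDG, §2.1].
-/

namespace Literature.Combinatorics.SimpleGraph.MoserMoser1961

open Real

/-- The 11 edges of the Moser spindle on vertex set `Fin 7`.  Numbering: `0` = origin, `1 = (1,0)`,
`2 = (1/2, √3/2)`, `3 = (3/2, √3/2)` (tip of the first rhombus), `4 = θ₃(1,0)`, `5 = θ₃(1/2,√3/2)`,
`6 = θ₃(3/2,√3/2)` (tip of the rotated rhombus); the last edge `(3,6)` joins the two tips.
[cite: Heule2018SmallUDG, §2.1] -/
def edges : List (Fin 7 × Fin 7) :=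
  [(0,1), (0,2), (1,2), (1,3), (2,3), (0,4), (0,5), (4,5), (4,6), (5,6), (3,6)]

/-- The Moser spindle as a simple graph on `Fin 7`: `i ~ j` iff `(i,j)` or `(j,i)` is one of the 11 `edges`.
[cite: MoserMoser1961, p. 187] -/
def moserSpindle : SimpleGraph (Fin 7) :=
  SimpleGraph.fromRel fun i j => (i, j) ∈ edges

/-- Adjacency in the Moser spindle is decidable (membership in a finite edge list). [folklore] -/
instance : DecidableRel moserSpindle.Adj := fun i j => by
  unfold moserSpindle; infer_instance

/-- Exact planar coordinates of the seven vertices, in `ℚ(√3, √11)` (we write `√33` as `√3 * √11`):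
`(A ⊕ B) ∪ θ₃(A ⊕ B)` with `cos θ₃ = 5/6`, `sin θ₃ = √11/6`. [cite: Heule2018SmallUDG, §2.1] -/
noncomputable def pt : Fin 7 → ℝ × ℝ
  | 0 => (0, 0)
  | 1 => (1, 0)
  | 2 => (1/2, √3/2)
  | 3 => (3/2, √3/2)
  | 4 => (5/6, √11/6)
  | 5 => (5/12 - √3*√11/12, √11/12 + 5*√3/12)
  | 6 => (5/4 - √3*√11/12, √11/4 + 5*√3/12)

/-- Squared Euclidean distance of two points of `ℝ × ℝ` (kept elementary on purpose: exact identities only).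
[folklore] -/
def sqDist (p q : ℝ × ℝ) : ℝ := (p.1 - q.1) ^ 2 + (p.2 - q.2) ^ 2

/-- `(√3)² = 3` (plumbing). [folklore] -/
private lemma s3 : (√3 : ℝ) ^ 2 = 3 := Real.sq_sqrt (by norm_num)
/-- `(√11)² = 11` (plumbing). [folklore] -/
private lemma s11 : (√11 : ℝ) ^ 2 = 11 := Real.sq_sqrt (by norm_num)

/-- Every listed edge has squared length exactly `1` in the embedding `pt` (11 exact identities in `ℚ(√3,√11)`).
[cite: MoserMoser1961, p. 187] -/
theorem edges_sqDist_eq_one : ∀ e ∈ edges, sqDist (pt e.1) (pt e.2) = 1 := by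
  simp only [edges, List.mem_cons, List.not_mem_nil, or_false]
  rintro e (rfl | rfl | rfl | rfl | rfl | rfl | rfl | rfl | rfl | rfl | rfl)
  all_goals (simp only [sqDist, pt]; ring_nf; try (simp only [s3, s11]; norm_num))

/-- Adjacent vertices of the Moser spindle are at Euclidean squared distance exactly `1` under `pt`:
the spindle is a unit-distance graph. [cite: MoserMoser1961, p. 187] -/
theorem adj_sqDist_eq_one {i j : Fin 7} (h : moserSpindle.Adj i j) : sqDist (pt i) (pt j) = 1 := by
  rcases h with ⟨-, hij | hji⟩
  · exact edges_sqDist_eq_one (i, j) hij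
  · have := edges_sqDist_eq_one (j, i) hji
    simp only [sqDist] at this ⊢
    linarith [this]

/-- The seven points are pairwise distinct (so `pt` is an embedding of the vertex set into the plane).
Distinctness is read off exactly: two points with equal coordinates would give a rational value for `√3` or `√11`
or contradict `(√3)² = 3`; "seven points" as printed. [cite: MoserMoser1961, p. 187] -/
theorem pt_injective : Function.Injective pt := by
  have h3 : (0:ℝ) < √3 := Real.sqrt_pos.mpr (by norm_num)
  have h11 : (0:ℝ) < √11 := Real.sqrt_pos.mpr (by norm_num)
  have h311 : √3 < √11 := Real.sqrt_lt_sqrt (by norm_num) (by norm_num)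
  have hs3 := s3; have hs11 := s11
  intro i j hij
  have h1 := congrArg Prod.fst hij; have h2 := congrArg Prod.snd hij
  fin_cases i <;> fin_cases j <;> simp only [pt] at h1 h2 <;> first | rfl | (exfalso; nlinarith [h3, h11, h311, hs3, hs11])

/-- Finite core of the non-3-colourability: for every assignment of three colours to the seven vertices some
edge of the spindle is monochromatic (3⁷ = 2187 cases, by `decide`). [cite: MoserMoser1961, p. 187] -/
theorem exists_mono_edge_three (f : Fin 7 → Fin 3) : ∃ e ∈ edges, f e.1 = f e.2 := by
  have key : ∀ a b c d e g h : Fin 3,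
      a = b ∨ a = c ∨ b = c ∨ b = d ∨ c = d ∨ a = e ∨ a = g ∨ e = g ∨ e = h ∨ g = h ∨ d = h := by decide
  rcases key (f 0) (f 1) (f 2) (f 3) (f 4) (f 5) (f 6) with q|q|q|q|q|q|q|q|q|q|q
  · exact ⟨(0,1), by simp [edges], q⟩
  · exact ⟨(0,2), by simp [edges], q⟩
  · exact ⟨(1,2), by simp [edges], q⟩
  · exact ⟨(1,3), by simp [edges], q⟩
  · exact ⟨(2,3), by simp [edges], q⟩
  · exact ⟨(0,4), by simp [edges], q⟩
  · exact ⟨(0,5), by simp [edges], q⟩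
  · exact ⟨(4,5), by simp [edges], q⟩
  · exact ⟨(4,6), by simp [edges], q⟩
  · exact ⟨(5,6), by simp [edges], q⟩
  · exact ⟨(3,6), by simp [edges], q⟩

/-- Listed edges are edges of `moserSpindle` (plumbing). [folklore] -/
private theorem adj_of_mem_edges {e : Fin 7 × Fin 7} (he : e ∈ edges) : moserSpindle.Adj e.1 e.2 := by
  refine ⟨?_, Or.inl he⟩
  revert he; revert e; decide

/-- **The Moser spindle is not 3-colourable.** [cite: MoserMoser1961, p. 187] -/
theorem not_colorable_three : ¬ moserSpindle.Colorable 3 := by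
  rintro ⟨C⟩
  obtain ⟨e, he, hmono⟩ := exists_mono_edge_three C
  exact C.valid (adj_of_mem_edges he) hmono

/-- An explicit proper 4-colouring of the Moser spindle. [folklore] -/
def fourColouring : Fin 7 → Fin 4
  | 0 => 0 | 1 => 1 | 2 => 2 | 3 => 0 | 4 => 1 | 5 => 2 | 6 => 3

/-- **The Moser spindle is 4-colourable** (so its chromatic number is exactly 4). [cite: MoserMoser1961, p. 187] -/
theorem colorable_four : moserSpindle.Colorable 4 :=
  ⟨SimpleGraph.Coloring.mk fourColouring (by
    intro v w h
    have hvw : (v, w) ∈ edges ∨ (w, v) ∈ edges := h.2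
    revert hvw; revert v w; decide)⟩

/-- The chromatic number of the Moser spindle is `4`. [cite: MoserMoser1961, p. 187] -/
theorem chromaticNumber_eq_four : moserSpindle.chromaticNumber = 4 := by
  rw [show (4 : ℕ∞) = (3 : ℕ) + 1 by norm_num]
  exact SimpleGraph.chromaticNumber_eq_iff_colorable_not_colorable.mpr ⟨colorable_four, not_colorable_three⟩

end Literature.Combinatorics.SimpleGraph.MoserMoser1961
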